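import Summits.HodgeConjecture.HodgeConjecture.Theorems.SecondaryPeriodsConiveauOneFailureTransfer
import Summits.HodgeConjecture.HodgeConjecture.Theorems.SecondaryPeriodsLevelOneConiveauThreefoldsCurveCorrespondencesConverse
import Summits.HodgeConjecture.HodgeConjecture.Theorems.SecondaryPeriodsLevelOneConiveauThreefoldsCurveCorrespondencesRankTwo

/-!
# Route `SecondaryPeriods`, crux `ConiveauOneFailure` (stmt-HodgeConjecture-3540): the heart of the
# line in INSTRUMENT FORM — one non-algebraic curve correspondence into a Calabi–Yau-type threefold

The registered line of the crux (`Cruxes/ConiveauOneFailure/Lines/birth.lean`) is closed modulo its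
heart `stub_attractorPlane_offCurveCorrespondences`: a smooth projective threefold `Y` with
`h^{3,0}(Y) = 1`, a rational rank-2 level-one sub-Hodge structure `V ⊂ H³(Y(ℂ))` ("attractor plane")
and NO finite family of algebraic curve correspondences carrying `V`. The route's instrument (secondary
periods, Lemma A, Beilinson–Bloch) does not see finite families of correspondences; it sees ONE class:
the graph `γ_V ∈ H⁴((Y × E)(ℂ))` of an identification `H¹(E)(−1) ≅ V`. This file proves, with no
hypothesis, that the two forms of the heart are EQUIVALENT, by combining three landed results of the
two leads of the sibling cruxes:

* rank-two Riemann (`levelOneSpanOfCurve_of_finrank_eq_two`, from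
  `Literature/…/LevelOneSubHodgeStructuresOfCurvesRankTwo`): a rational rank-2 level-one sub-Hodge
  structure of `H³(Y)` is the image `φ(H¹(C(ℂ)))` of a rational type-`(1,1)` map from a smooth
  projective curve (an elliptic curve);
* the pointwise converse transfer (`curveCorrespondenceAlgebraic_of_range_le_supportedClasses`,
  Grothendieck 1969 p. 301 / Abdulali Prop. 3.2 on the tree's carriers): a rational type-`(1,1)` map
  `φ : H¹(C(ℂ)) → H³(Y(ℂ))` whose image lies in `N¹H³(Y)` is the action of an ALGEBRAIC codimension-2
  class on `Y ⊗ C`;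
* the transfer of this crux (`iSup_range_le_supportedClasses_of_isAlgebraicCorrespondence_curve`):
  whatever finitely many algebraic curve correspondences carry lies in `N¹H³(Y)`.

Results:

* `curveCorrespondenceAlgebraic_of_range_le_carried` — if `im φ` is carried by finitely many algebraic
  curve correspondences then `φ` itself is algebraic (for every orientation family);
* `carried_of_le_range_corrAction` — conversely the image of an algebraic correspondence is carried;
* `heart_iff_exists_nonalgebraic_curveCorrespondence` — **the heart ⟺ its instrument form**: some
  smooth projective threefold `Y` with `h^{3,0} = 1`, smooth projective curve `C` and rational
  type-`(1,1)` map `φ : H¹(C(ℂ)) → H³(Y(ℂ))` with `dim im φ = 2` such that for NO orientation family is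
  `φ` the action `[γ]_*` of an algebraic class `γ ∈ N²H⁴((Y ⊗ C)(ℂ))` — i.e. the Hodge conjecture
  fails for the Künneth-`(3,1)` Hodge class of `φ` on the fourfold `Y × C`;
* `coniveauOneFailure_of_nonalgebraic_curveCorrespondence_finrankTwo` — the instrument form implies
  the crux; `not_hodgeConjecture_of_nonalgebraic_curveCorrespondence_finrankTwo` — and refutes HC.

So after this file the open content of the crux, in the line's habitat, reads: exhibit `(Y, C, φ)` as
above and certify that the single codimension-2 Hodge class of `φ` on `Y × C` is not algebraic — the
exact input of the route's Lemma A / Beilinson–Bloch instrument (cruxes #4–#5), and an open problem.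

## References

* [GrothendieckTopology1969] A. Grothendieck, Hodge's general conjecture is false for trivial
  reasons, Topology 8 (1969), p. 301.
* [KerrPearlstein2016] M. Kerr, G. Pearlstein (eds.), Recent Advances in Hodge Theory, Ch. 11
  (S. Abdulali), §1 p. 288 and Prop. 3.2 p. 291.
* [VoisinHodgeI2002] C. Voisin, Hodge Theory and Complex Algebraic Geometry I, §7.2.2, §7.3.1
  Lemma 7.26, §11.3.3 Lemma 11.41.
* [CandelasEtAl2020] P. Candelas, X. de la Ossa, M. Elmi, D. van Straten, A one parameter family of
  Calabi–Yau manifolds with attractor points of rank two, §6.  * [BonischEtAl2024] K. Bönisch,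
  A. Klemm, E. Scheidegger, D. Zagier, §3.3.
-/

noncomputable section

-- every declaration of this problem lives in `Summit.HodgeConjecture.HodgeConjecture.…` (summit = sub-problem), which `linter.dupNamespace` flags
set_option linter.dupNamespace false

namespace Summit.HodgeConjecture.HodgeConjecture.Theorems

open CategoryTheory MonoidalCategory
open Literature.AlgebraicGeometry.Motives Literature.AlgebraicGeometry.HodgeTheory
  Literature.AlgebraicTopology.SingularHomology
open Summit.HodgeConjecture.HodgeConjecture.Theses.SecondaryPeriods (ConiveauOneFailure)

/-! ### Carried by finitely many curve correspondences ⟹ the correspondence itself is algebraic -/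

/-- **If the image of a rational type-`(1,1)` curve correspondence `φ : H¹(C(ℂ)) → H³(Y(ℂ))` is
carried by finitely many algebraic curve correspondences, then `φ` is itself the action of an
algebraic codimension-2 class on `Y ⊗ C`** (for every orientation family): the carriers lie in
`N¹H³(Y)` (`iSup_range_le_supportedClasses_of_isAlgebraicCorrespondence_curve`), and a rational
type-`(1,1)` map into `N¹H³(Y)` is algebraic (`curveCorrespondenceAlgebraic_of_range_le_supportedClasses`:
Deligne 8.2.8 + Hironaka, semisimple lift through the surface Gysin maps, Lefschetz `(1,1)` on
`S_j × C`, push-forward). [cite: GrothendieckTopology1969, p. 301]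
[cite: KerrPearlstein2016, Ch. 11 (Abdulali) Prop. 3.2 p. 291] -/
theorem curveCorrespondenceAlgebraic_of_range_le_carried {Y C : SchemeOver ℂ}
    (hY : IsSmoothProjective 3 Y) (hC : IsSmoothProjective 1 C) (A : HodgeModel 3 Y)
    (B : HodgeModel 1 C) (φ : complexBetti C 1 →ₗ[ℂ] complexBetti Y 3)
    (hφ : ∀ c, IsRationalClass c → IsRationalClass (φ c))
    (hφH : ∀ (p q : ℕ), p + q = 1 → ∀ c, B.pullback 1 c ∈ B.hodgePQ 1 p q →
      A.pullback 3 (φ c) ∈ A.hodgePQ 3 (p + 1) (q + 1))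
    {ι : Type} {C' : ι → SchemeOver ℂ} (hC' : ∀ j, IsSmoothProjective 1 (C' j))
    {T : ∀ j, complexBetti (C' j) 1 →ₗ[ℂ] complexBetti Y 3}
    (hT : ∀ j, IsAlgebraicCorrespondence 3 1 Y (C' j) (T j))
    (hle : LinearMap.range φ ≤ ⨆ j, LinearMap.range (T j)) (μ : OrientationFamily) :
    ∃ γ ∈ algebraicClasses (Y ⊗ C) 2,
      corrAction μ hY hC (show 1 + 2 * 2 = 3 + 2 * 1 from rfl) γ = φ :=
  curveCorrespondenceAlgebraic_of_range_le_supportedClasses hY hC A B φ hφ hφH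
    (hle.trans (iSup_range_le_supportedClasses_of_isAlgebraicCorrespondence_curve hY hC' hT)) μ

/-- **The image of an algebraic curve correspondence is carried** (by the one-member family it
forms): if `V ⊆ im [γ]_*` with `γ ∈ N²H⁴((Y ⊗ C)(ℂ))` algebraic, then `V` is carried by finitely many
algebraic curve correspondences (`isAlgebraicCorrespondence_corrAction`). [cite: GrothendieckTopology1969, p. 301] -/
theorem carried_of_le_range_corrAction {Y C : SchemeOver ℂ} (hY : IsSmoothProjective 3 Y)
    (hC : IsSmoothProjective 1 C) (μ : OrientationFamily) {γ : complexBetti (Y ⊗ C) (2 * 2)}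
    (hγ : γ ∈ algebraicClasses (Y ⊗ C) 2) {V : Submodule ℂ (complexBetti Y 3)}
    (hV : V ≤ LinearMap.range (corrAction μ hY hC (show 1 + 2 * 2 = 3 + 2 * 1 from rfl) γ)) :
    ∃ (ι : Type) (_ : Finite ι) (C' : ι → SchemeOver ℂ) (_ : ∀ j, IsSmoothProjective 1 (C' j))
      (T : ∀ j, complexBetti (C' j) 1 →ₗ[ℂ] complexBetti Y 3),
      (∀ j, IsAlgebraicCorrespondence 3 1 Y (C' j) (T j)) ∧ V ≤ ⨆ j, LinearMap.range (T j) :=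
  ⟨Unit, inferInstance, fun _ ↦ C, fun _ ↦ hC,
    fun _ ↦ corrAction μ hY hC (show 1 + 2 * 2 = 3 + 2 * 1 from rfl) γ,
    fun _ ↦ isAlgebraicCorrespondence_corrAction μ (OrientationFamily.hasPoincareDuality μ) hY hC
      (show 1 + 2 * 2 = 3 + 2 * 1 from rfl) (show 3 + 3 = 2 * 3 from rfl) hγ,
    hV.trans (le_iSup (fun _ : Unit ↦ LinearMap.range
      (corrAction μ hY hC (show 1 + 2 * 2 = 3 + 2 * 1 from rfl) γ)) ())⟩

/-! ### The heart of the line ⟺ its instrument form -/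

/-- **The heart of the registered line of `ConiveauOneFailure` in instrument form (PROVED
equivalence).** The following are equivalent:
(a) [the registered heart `stub_attractorPlane_offCurveCorrespondences`, unfolded] some smooth
projective threefold `Y` with `h^{3,0}(Y) = 1` carries a finite set `s` of rational classes of
`H³(Y(ℂ))` whose span is sub-Hodge (for a Hodge model `A`), of level one and of dimension `2`, carried
by NO finite family of algebraic curve correspondences `H¹(C_j(ℂ)) → H³(Y(ℂ))`;
(b) some smooth projective threefold `Y` with `h^{3,0}(Y) = 1` receives, from some smooth projective
curve `C`, a rational type-`(1,1)` map `φ : H¹(C(ℂ)) → H³(Y(ℂ))` (rational classes to rational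
classes, `H^{p,q} → H^{p+1,q+1}` in Hodge models `B`, `A`) with `dim im φ = 2` which, for NO
orientation family, is the action `[γ]_*` of an algebraic codimension-2 class `γ` on `Y ⊗ C` —
the Hodge conjecture fails for the Künneth-`(3,1)` class of `φ` on the fourfold `Y × C`.
(a ⟹ b): rank-two Riemann (`levelOneSpanOfCurve_of_finrank_eq_two`) realises the plane as `im φ`,
and an algebraic `φ` would carry it. (b ⟹ a): `im φ` is rationally spanned, sub-Hodge and of level
one (`exists_finset_span_eq_range`), and carriers of `im φ` would make `φ` algebraic
(`curveCorrespondenceAlgebraic_of_range_le_carried`). Form (b) is the object on which the route's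
Lemma A / Beilinson–Bloch instrument operates (one codimension-2 class on `Y × E`).
[cite: GrothendieckTopology1969, p. 301] [cite: VoisinHodgeI2002, §7.2.2 and §11.3.3 Lemma 11.41]
[cite: KerrPearlstein2016, Ch. 11 (Abdulali) Prop. 3.2 p. 291] [cite: CandelasEtAl2020, §6] -/
theorem heart_iff_exists_nonalgebraic_curveCorrespondence :
    (∃ (Y : SchemeOver ℂ) (_ : IsSmoothProjective 3 Y) (A : HodgeModel 3 Y)
      (s : Finset (complexBetti Y 3)),
      (∀ c ∈ s, IsRationalClass c) ∧
      (Submodule.span ℂ (↑s : Set (complexBetti Y 3))).map (A.pullback 3).hom =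
        (⨆ (p : ℕ) (q : ℕ) (_ : p + q = 3),
          (Submodule.span ℂ (↑s : Set (complexBetti Y 3))).map (A.pullback 3).hom ⊓
            A.hodgePQ 3 p q) ∧
      (Submodule.span ℂ (↑s : Set (complexBetti Y 3))).map (A.pullback 3).hom ≤
        (⨆ (p : ℕ) (q : ℕ) (_ : p + q = 3) (_ : 1 ≤ p) (_ : 1 ≤ q), A.hodgePQ 3 p q) ∧
      Module.finrank ℂ (A.hodgePQ 3 3 0) = 1 ∧
      Module.finrank ℂ (Submodule.span ℂ (↑s : Set (complexBetti Y 3))) = 2 ∧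
      ¬ ∃ (ι : Type) (_ : Finite ι) (C : ι → SchemeOver ℂ) (_ : ∀ j, IsSmoothProjective 1 (C j))
          (T : ∀ j, complexBetti (C j) 1 →ₗ[ℂ] complexBetti Y 3),
          (∀ j, IsAlgebraicCorrespondence 3 1 Y (C j) (T j)) ∧
            Submodule.span ℂ (↑s : Set (complexBetti Y 3)) ≤ ⨆ j, LinearMap.range (T j)) ↔
    ∃ (Y : SchemeOver ℂ) (hY : IsSmoothProjective 3 Y) (A : HodgeModel 3 Y) (C : SchemeOver ℂ)
      (hC : IsSmoothProjective 1 C) (B : HodgeModel 1 C) (φ : complexBetti C 1 →ₗ[ℂ] complexBetti Y 3),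
      (∀ c, IsRationalClass c → IsRationalClass (φ c)) ∧
      (∀ (p q : ℕ), p + q = 1 → ∀ c, B.pullback 1 c ∈ B.hodgePQ 1 p q →
        A.pullback 3 (φ c) ∈ A.hodgePQ 3 (p + 1) (q + 1)) ∧
      Module.finrank ℂ (A.hodgePQ 3 3 0) = 1 ∧
      Module.finrank ℂ (LinearMap.range φ) = 2 ∧
      ∀ μ : OrientationFamily, ¬ ∃ γ ∈ algebraicClasses (Y ⊗ C) 2,
        corrAction μ hY hC (show 1 + 2 * 2 = 3 + 2 * 1 from rfl) γ = φ := by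
  constructor
  · rintro ⟨Y, hY, A, s, hs, hsub, hlev, h30, hs2, hoff⟩
    obtain ⟨C, hC, B, φ, hφ, hφH, hrange⟩ :=
      levelOneSpanOfCurve_of_finrank_eq_two hY A s hs hs2 hsub hlev
    refine ⟨Y, hY, A, C, hC, B, φ, hφ, hφH, h30, by rw [hrange]; exact hs2, fun μ ↦ ?_⟩
    rintro ⟨γ, hγ, hγφ⟩
    exact hoff (carried_of_le_range_corrAction hY hC μ hγ (by rw [hγφ, hrange]))
  · rintro ⟨Y, hY, A, C, hC, B, φ, hφ, hφH, h30, hr2, hnon⟩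
    obtain ⟨s, hs, hspan, hsub, hlev⟩ := exists_finset_span_eq_range hC A B φ hφ hφH
    refine ⟨Y, hY, A, s, hs, hsub, hlev, h30, by rw [hspan]; exact hr2, ?_⟩
    rintro ⟨ι, -, C', hC', T, hT, hle⟩
    exact hnon complexOrientationFamily (curveCorrespondenceAlgebraic_of_range_le_carried hY hC A B φ
      hφ hφH hC' hT (hspan ▸ hle) complexOrientationFamily)

/-! ### The instrument form implies the crux, and refutes the Hodge conjecture -/

/-- **A non-algebraic rank-two level-one curve correspondence into a Calabi–Yau-type threefold gives
`ConiveauOneFailure`** (the crux stmt-HodgeConjecture-3540, ¬GHC(3,1)): instrument form ⟹ heart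
(`heart_iff_exists_nonalgebraic_curveCorrespondence`) ⟹ crux (`coniveauOneFailure_of_heart`).
[cite: GrothendieckTopology1969, p. 301] [cite: CandelasEtAl2020, §6] [cite: BonischEtAl2024, §3.3] -/
theorem coniveauOneFailure_of_nonalgebraic_curveCorrespondence_finrankTwo
    (h : ∃ (Y : SchemeOver ℂ) (hY : IsSmoothProjective 3 Y) (A : HodgeModel 3 Y) (C : SchemeOver ℂ)
      (hC : IsSmoothProjective 1 C) (B : HodgeModel 1 C) (φ : complexBetti C 1 →ₗ[ℂ] complexBetti Y 3),
      (∀ c, IsRationalClass c → IsRationalClass (φ c)) ∧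
      (∀ (p q : ℕ), p + q = 1 → ∀ c, B.pullback 1 c ∈ B.hodgePQ 1 p q →
        A.pullback 3 (φ c) ∈ A.hodgePQ 3 (p + 1) (q + 1)) ∧
      Module.finrank ℂ (A.hodgePQ 3 3 0) = 1 ∧
      Module.finrank ℂ (LinearMap.range φ) = 2 ∧
      ∀ μ : OrientationFamily, ¬ ∃ γ ∈ algebraicClasses (Y ⊗ C) 2,
        corrAction μ hY hC (show 1 + 2 * 2 = 3 + 2 * 1 from rfl) γ = φ) :
    ConiveauOneFailure :=
  coniveauOneFailure_of_heart (heart_iff_exists_nonalgebraic_curveCorrespondence.2 h)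

/-- **… and refutes the Hodge conjecture with no further input**: the plane `im φ` is a rank-two
witness of `ConiveauOneFailure` (not in `N¹H³(Y)` by `le_supportedClasses_iff_exists_curveCorrespondences`),
to which `not_hodgeConjecture_of_coniveauOneFailure_finrankTwo` applies (HC for `Y × E` would make the
Künneth class of `φ` algebraic). [cite: GrothendieckTopology1969, p. 301]
[cite: KerrPearlstein2016, Ch. 11 (Abdulali) Prop. 3.2 p. 291] -/
theorem not_hodgeConjecture_of_nonalgebraic_curveCorrespondence_finrankTwo
    (h : ∃ (Y : SchemeOver ℂ) (hY : IsSmoothProjective 3 Y) (A : HodgeModel 3 Y) (C : SchemeOver ℂ)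
      (hC : IsSmoothProjective 1 C) (B : HodgeModel 1 C) (φ : complexBetti C 1 →ₗ[ℂ] complexBetti Y 3),
      (∀ c, IsRationalClass c → IsRationalClass (φ c)) ∧
      (∀ (p q : ℕ), p + q = 1 → ∀ c, B.pullback 1 c ∈ B.hodgePQ 1 p q →
        A.pullback 3 (φ c) ∈ A.hodgePQ 3 (p + 1) (q + 1)) ∧
      Module.finrank ℂ (A.hodgePQ 3 3 0) = 1 ∧
      Module.finrank ℂ (LinearMap.range φ) = 2 ∧
      ∀ μ : OrientationFamily, ¬ ∃ γ ∈ algebraicClasses (Y ⊗ C) 2,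
        corrAction μ hY hC (show 1 + 2 * 2 = 3 + 2 * 1 from rfl) γ = φ) :
    ¬ _root_.HodgeConjecture := by
  obtain ⟨Y, hY, A, s, hs, hsub, hlev, -, hs2, hoff⟩ :=
    heart_iff_exists_nonalgebraic_curveCorrespondence.2 h
  exact not_hodgeConjecture_of_coniveauOneFailure_finrankTwo ⟨Y, hY, A, s, hs, hs2, hsub, hlev,
    fun hle ↦ hoff ((le_supportedClasses_iff_exists_curveCorrespondences hY _).1 hle)⟩

/-! ### Appended (lead c2, 2026-08-17): the heart against the habitat-positive item `AttractorPlanesConiveauOne` -/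

open Summit.HodgeConjecture.HodgeConjecture.Theses.SecondaryPeriods (AttractorPlanesConiveauOne) in
/-- **The heart refutes the habitat-positive item of the route.** If the registered heart of the line
holds (an attractor plane of a Calabi–Yau-type threefold carried by no finite family of algebraic curve
correspondences), then `AttractorPlanesConiveauOne` (stmt-HodgeConjecture-10377: GHC(3,1) for
threefolds with `h^{3,0} = 1`) fails — the plane is not in `N¹H³(Y)` by the proved transfer
`le_supportedClasses_iff_exists_curveCorrespondences`. So the two open leaves of the route at the
habitat, this crux's heart and the support item 10377, are formal opposites (see
`heart_iff_not_attractorPlanesConiveauOne_finrankTwo` for the exact equivalence in rank two).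
[cite: GrothendieckTopology1969, p. 301] [cite: CandelasEtAl2020, §6] -/
theorem not_attractorPlanesConiveauOne_of_heart
    (h : ∃ (Y : SchemeOver ℂ) (_ : IsSmoothProjective 3 Y) (A : HodgeModel 3 Y)
      (s : Finset (complexBetti Y 3)),
      (∀ c ∈ s, IsRationalClass c) ∧
      (Submodule.span ℂ (↑s : Set (complexBetti Y 3))).map (A.pullback 3).hom =
        (⨆ (p : ℕ) (q : ℕ) (_ : p + q = 3),
          (Submodule.span ℂ (↑s : Set (complexBetti Y 3))).map (A.pullback 3).hom ⊓
            A.hodgePQ 3 p q) ∧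
      (Submodule.span ℂ (↑s : Set (complexBetti Y 3))).map (A.pullback 3).hom ≤
        (⨆ (p : ℕ) (q : ℕ) (_ : p + q = 3) (_ : 1 ≤ p) (_ : 1 ≤ q), A.hodgePQ 3 p q) ∧
      Module.finrank ℂ (A.hodgePQ 3 3 0) = 1 ∧
      Module.finrank ℂ (Submodule.span ℂ (↑s : Set (complexBetti Y 3))) = 2 ∧
      ¬ ∃ (ι : Type) (_ : Finite ι) (C : ι → SchemeOver ℂ) (_ : ∀ j, IsSmoothProjective 1 (C j))
          (T : ∀ j, complexBetti (C j) 1 →ₗ[ℂ] complexBetti Y 3),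
          (∀ j, IsAlgebraicCorrespondence 3 1 Y (C j) (T j)) ∧
            Submodule.span ℂ (↑s : Set (complexBetti Y 3)) ≤ ⨆ j, LinearMap.range (T j)) :
    ¬ AttractorPlanesConiveauOne := by
  obtain ⟨Y, hY, A, s, hs, hsub, hlev, h30, -, hoff⟩ := h
  exact fun hA ↦ hoff ((le_supportedClasses_iff_exists_curveCorrespondences hY _).1
    (hA hY A h30 s hs hsub hlev))

/-- **The heart ⟺ the failure of `AttractorPlanesConiveauOne` in rank two (PROVED equivalence).**
The registered heart of the line holds iff it is NOT the case that on every smooth projective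
threefold with `h^{3,0} = 1` every rationally spanned sub-Hodge structure of `H³` of level one and of
rank `2` lies in `N¹H³` — i.e. iff the rank-two case of the route's habitat-positive item
`AttractorPlanesConiveauOne` (stmt-HodgeConjecture-10377) fails. (`N¹H³ =` carried by finitely many
algebraic curve correspondences, `le_supportedClasses_iff_exists_curveCorrespondences`.)
[cite: GrothendieckTopology1969, p. 301] [cite: CandelasEtAl2020, §6] [cite: BonischEtAl2024, §3.3] -/
theorem heart_iff_not_attractorPlanesConiveauOne_finrankTwo :
    (∃ (Y : SchemeOver ℂ) (_ : IsSmoothProjective 3 Y) (A : HodgeModel 3 Y)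
      (s : Finset (complexBetti Y 3)),
      (∀ c ∈ s, IsRationalClass c) ∧
      (Submodule.span ℂ (↑s : Set (complexBetti Y 3))).map (A.pullback 3).hom =
        (⨆ (p : ℕ) (q : ℕ) (_ : p + q = 3),
          (Submodule.span ℂ (↑s : Set (complexBetti Y 3))).map (A.pullback 3).hom ⊓
            A.hodgePQ 3 p q) ∧
      (Submodule.span ℂ (↑s : Set (complexBetti Y 3))).map (A.pullback 3).hom ≤
        (⨆ (p : ℕ) (q : ℕ) (_ : p + q = 3) (_ : 1 ≤ p) (_ : 1 ≤ q), A.hodgePQ 3 p q) ∧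
      Module.finrank ℂ (A.hodgePQ 3 3 0) = 1 ∧
      Module.finrank ℂ (Submodule.span ℂ (↑s : Set (complexBetti Y 3))) = 2 ∧
      ¬ ∃ (ι : Type) (_ : Finite ι) (C : ι → SchemeOver ℂ) (_ : ∀ j, IsSmoothProjective 1 (C j))
          (T : ∀ j, complexBetti (C j) 1 →ₗ[ℂ] complexBetti Y 3),
          (∀ j, IsAlgebraicCorrespondence 3 1 Y (C j) (T j)) ∧
            Submodule.span ℂ (↑s : Set (complexBetti Y 3)) ≤ ⨆ j, LinearMap.range (T j)) ↔
    ¬ ∀ ⦃Y : SchemeOver ℂ⦄, IsSmoothProjective 3 Y → ∀ (A : HodgeModel 3 Y),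
        Module.finrank ℂ (A.hodgePQ 3 3 0) = 1 → ∀ (s : Finset (complexBetti Y 3)),
        (∀ c ∈ s, IsRationalClass c) →
        Module.finrank ℂ (Submodule.span ℂ (↑s : Set (complexBetti Y 3))) = 2 →
        (Submodule.span ℂ (↑s : Set (complexBetti Y 3))).map (A.pullback 3).hom =
          (⨆ (p : ℕ) (q : ℕ) (_ : p + q = 3),
            (Submodule.span ℂ (↑s : Set (complexBetti Y 3))).map (A.pullback 3).hom ⊓
              A.hodgePQ 3 p q) →
        (Submodule.span ℂ (↑s : Set (complexBetti Y 3))).map (A.pullback 3).hom ≤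
          (⨆ (p : ℕ) (q : ℕ) (_ : p + q = 3) (_ : 1 ≤ p) (_ : 1 ≤ q), A.hodgePQ 3 p q) →
        Submodule.span ℂ (↑s : Set (complexBetti Y 3)) ≤ supportedClasses Y 3 1 := by
  constructor
  · rintro ⟨Y, hY, A, s, hs, hsub, hlev, h30, hs2, hoff⟩ hA
    exact hoff ((le_supportedClasses_iff_exists_curveCorrespondences hY _).1
      (hA hY A h30 s hs hs2 hsub hlev))
  · intro hA
    by_contra hne
    refine hA fun Y hY A h30 s hs hs2 hsub hlev ↦ ?_
    by_contra hN
    exact hne ⟨Y, hY, A, s, hs, hsub, hlev, h30, hs2, fun hcar ↦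
      hN ((le_supportedClasses_iff_exists_curveCorrespondences hY _).2 hcar)⟩

end Summit.HodgeConjecture.HodgeConjecture.Theorems

end
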